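import Mathlib

/-!
# Product-plus-one line — CLOUD CORE in lens currency, III: the upper envelope, the mirror laws, and the
# SYNCHRONISED-COMPANY LAW (a global `≤ 1 sign change` class with unboundedly many clouds)

Helper file for `stmt-ValiantsHypothesis-18050` (`MatrixDescartes`), line `product_plus_one`, floor
`stub_oneChangeFloorK3`, open core (CL-F1) (clouds).  Sequel of `…ProductPlusOneLensCloudEnvelope` (p827068) and
`…LensCloudSwitch` (p827257); same dictionary (p3 g20 NOTE §8): a cloud is `(κ, p, r)`, phase
`y(u) = κ + p e^{-au} + r e^{bu}`, company phase velocity `Θ' = Σ_i y_i'/(1+y_i²) = -F₁`.  Def-free, Mathlib only.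
Nothing here closes a stub; VP ≠ VNP is not touched.

## What is proved
* UPPER-ENVELOPE FORM: `y' = e^{-au}·d(u)`, `d(u) := -a p + b r e^{(a+b)u}` (`rowVelocity_eq_top`), so
  `Θ' = e^{-au}·L(u)` with the UPPER REDUCED VELOCITY `L(u) = Σ_i d_i(u)/(1+y_i²)` (`phaseVelocity_eq_exp_mul_top`);
  `L' = Σ_i [ b(a+b) r_i e^{(a+b)u}(1+y_i²) - d_i·(2 y_i y_i') ]/(1+y_i²)²` with cross term `2 e^{-au} y_i d_i²`
  (`hasDerivAt_topVelocity`, `crossTerm_top`).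
* MIRROR LAWS: (L−) UPPER-ALIGNED company (`r_i ≤ 0` ⟺ `β_f γ_f ≥ 0`: T5, T1, rows with γ_f = 0) at POSITIVE phase ⇒
  `L' ≤ 0` (`< 0` if one `r_i < 0`), `L` strictly decreasing on positive-phase windows, `Θ'` vanishes at most once there
  (`topVelocity_deriv_nonpos/_neg`, `topVelocity_strictAntiOn`, `phaseVelocity_zero_subsingleton_top`);
  (L+) `r_i ≥ 0` at NEGATIVE phase ⇒ `L' ≥ 0` (`topSummand_deriv_nonneg`); (R+) `p_i ≥ 0` at negative phase ⇒ the
  lower reduced-velocity summand of p827068 has derivative `≥ 0` (`reducedSummand_deriv_nonneg`).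
* LOCALISATION in `L`-currency (`topVelocity_pos_below`, `topVelocity_neg_above`) and the
  **SYNCHRONISED-COMPANY LAW** (`topVelocity_zero_subsingleton_of_sync`, `phaseVelocity_zero_subsingleton_of_sync`):
  a pure T5 company (`p_i < 0`, `r_i < 0`) whose switch times `e^{(a+b)u_i*} = a|p_i|/(b|r_i|)` all lie in an
  interval `[lo, hi]` on which EVERY row keeps positive phase (`y_i ≥ 0`, i.e. `|β_f|x^a cos(πa/c) ≥ |α_f| + |γ_f|x^c`
  for all rows simultaneously) has a phase velocity `Θ' = -F₁` with AT MOST ONE ZERO ON THE WHOLE LINE — (CL-1′) with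
  constant 1 on an open class of companies with any number of clouds and no coefficient coincidence.
-/

set_option linter.dupNamespace false

open Real Finset BigOperators

namespace Summit.ValiantsHypothesis.ValiantsHypothesis.Theorems.LacunarySymmetroidMatrixDescartes.ProductPlusOne.LensCloudTop

variable {ι : Type*} [Fintype ι]

/-- `e^{-au} · e^{(a+b)u} = e^{bu}`. [folklore] -/
theorem exp_neg_mul_exp_add (a b u : ℝ) : exp (-(a * u)) * exp ((a + b) * u) = exp (b * u) := by
  rw [← Real.exp_add]; ring_nf

/-- **Upper envelope of the row velocity**: `y' = e^{-au}·(-a p + b r e^{(a+b)u})`. [this file's lemma] -/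
theorem rowVelocity_eq_top (a b p r u : ℝ) :
    -(a * p) * exp (-(a * u)) + b * r * exp (b * u)
      = exp (-(a * u)) * (-(a * p) + b * r * exp ((a + b) * u)) := by
  have h := exp_neg_mul_exp_add a b u
  linear_combination (-(b * r)) * h

/-- **UPPER-ENVELOPE FORM of the company phase velocity**: `Θ' = e^{-au}·L`. [this file's theorem] -/
theorem phaseVelocity_eq_exp_mul_top (a b κ u : ℝ) (p r : ι → ℝ) :
    ∑ i, (-(a * p i) * exp (-(a * u)) + b * r i * exp (b * u))
        / (1 + (κ + p i * exp (-(a * u)) + r i * exp (b * u)) ^ 2)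
      = exp (-(a * u)) * ∑ i, (-(a * p i) + b * r i * exp ((a + b) * u))
        / (1 + (κ + p i * exp (-(a * u)) + r i * exp (b * u)) ^ 2) := by
  rw [Finset.mul_sum]
  refine Finset.sum_congr rfl fun i _ => ?_
  rw [rowVelocity_eq_top, mul_div_assoc]

/-- zeros of `Θ'` are the zeros of `L`. [this file's lemma] -/
theorem phaseVelocity_eq_zero_iff_top (a b κ u : ℝ) (p r : ι → ℝ) :
    ∑ i, (-(a * p i) * exp (-(a * u)) + b * r i * exp (b * u))
        / (1 + (κ + p i * exp (-(a * u)) + r i * exp (b * u)) ^ 2) = 0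
      ↔ ∑ i, (-(a * p i) + b * r i * exp ((a + b) * u))
        / (1 + (κ + p i * exp (-(a * u)) + r i * exp (b * u)) ^ 2) = 0 := by
  rw [phaseVelocity_eq_exp_mul_top, mul_eq_zero]
  simp [(exp_pos _).ne']

/-- derivative of the upper coefficient `d(u) = -a p + b r e^{(a+b)u}`. [this file's lemma] -/
theorem hasDerivAt_topCoeff (a b p r u : ℝ) :
    HasDerivAt (fun u => -(a * p) + b * r * exp ((a + b) * u))
      (b * (a + b) * r * exp ((a + b) * u)) u := by
  have h1 : HasDerivAt (fun u : ℝ => (a + b) * u) (a + b) u := by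
    simpa using (hasDerivAt_id u).const_mul (a + b)
  have h2 : HasDerivAt (fun u : ℝ => exp ((a + b) * u)) (exp ((a + b) * u) * (a + b)) u := h1.exp
  have h3 := (h2.const_mul (b * r)).const_add (-(a * p))
  exact h3.congr_deriv (by ring)

/-- **Derivative of one summand of the upper reduced velocity** `d_i/(1+y_i²)` (quotient rule, raw form).
[this file's lemma] -/
theorem hasDerivAt_topSummand (a b κ p r u : ℝ) :
    HasDerivAt (fun u => (-(a * p) + b * r * exp ((a + b) * u))
        / (1 + (κ + p * exp (-(a * u)) + r * exp (b * u)) ^ 2))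
      (((b * (a + b) * r * exp ((a + b) * u)) * (1 + (κ + p * exp (-(a * u)) + r * exp (b * u)) ^ 2)
        - (-(a * p) + b * r * exp ((a + b) * u))
          * (2 * (κ + p * exp (-(a * u)) + r * exp (b * u))
            * (-(a * p) * exp (-(a * u)) + b * r * exp (b * u))))
        / (1 + (κ + p * exp (-(a * u)) + r * exp (b * u)) ^ 2) ^ 2) u := by
  have hc := hasDerivAt_topCoeff a b p r u
  have hy : HasDerivAt (fun u => κ + p * exp (-(a * u)) + r * exp (b * u))
      (-(a * p) * exp (-(a * u)) + b * r * exp (b * u)) u := by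
    have h1 : HasDerivAt (fun u : ℝ => -(a * u)) (-a) u := by
      simpa using (hasDerivAt_id u).const_mul (-a)
    have h2 : HasDerivAt (fun u : ℝ => exp (-(a * u))) (exp (-(a * u)) * (-a)) u := h1.exp
    have h3 : HasDerivAt (fun u : ℝ => b * u) b u := by
      simpa using (hasDerivAt_id u).const_mul b
    have h4 : HasDerivAt (fun u : ℝ => exp (b * u)) (exp (b * u) * b) u := h3.exp
    exact (((h2.const_mul p).const_add κ).add (h4.const_mul r)).congr_deriv (by ring)
  have hd : HasDerivAt (fun u => 1 + (κ + p * exp (-(a * u)) + r * exp (b * u)) ^ 2)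
      (2 * (κ + p * exp (-(a * u)) + r * exp (b * u))
        * (-(a * p) * exp (-(a * u)) + b * r * exp (b * u))) u := by
    refine ((hy.pow 2).const_add 1).congr_deriv ?_
    norm_num
  have hne : (1 + (κ + p * exp (-(a * u)) + r * exp (b * u)) ^ 2) ≠ 0 := by positivity
  exact hc.div hd hne

/-- **the upper cross term is a square times the phase**: `d·(2 y y') = 2 e^{-au} y d²`. [this file's lemma] -/
theorem crossTerm_top (a b κ p r u : ℝ) :
    (-(a * p) + b * r * exp ((a + b) * u))
        * (2 * (κ + p * exp (-(a * u)) + r * exp (b * u))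
          * (-(a * p) * exp (-(a * u)) + b * r * exp (b * u)))
      = 2 * exp (-(a * u)) * (κ + p * exp (-(a * u)) + r * exp (b * u))
          * (-(a * p) + b * r * exp ((a + b) * u)) ^ 2 := by
  rw [rowVelocity_eq_top]
  ring

/-- **MIRROR LAW (L−), one row**: upper-aligned row (`r ≤ 0`) at positive phase (`y ≥ 0`), `0 ≤ b`, `0 ≤ a+b`
⇒ the upper summand is non-increasing. [this file's theorem] -/
theorem topSummand_deriv_nonpos (a b κ p r u : ℝ) (hb : 0 ≤ b) (hab : 0 ≤ a + b) (hr : r ≤ 0)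
    (hy : 0 ≤ κ + p * exp (-(a * u)) + r * exp (b * u)) :
    ((b * (a + b) * r * exp ((a + b) * u)) * (1 + (κ + p * exp (-(a * u)) + r * exp (b * u)) ^ 2)
        - (-(a * p) + b * r * exp ((a + b) * u))
          * (2 * (κ + p * exp (-(a * u)) + r * exp (b * u))
            * (-(a * p) * exp (-(a * u)) + b * r * exp (b * u))))
        / (1 + (κ + p * exp (-(a * u)) + r * exp (b * u)) ^ 2) ^ 2 ≤ 0 := by
  rw [crossTerm_top]
  apply div_nonpos_of_nonpos_of_nonneg _ (by positivity)
  have h1 : b * (a + b) * r * exp ((a + b) * u) * (1 + (κ + p * exp (-(a * u)) + r * exp (b * u)) ^ 2)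
      ≤ 0 := by
    have : b * (a + b) * r ≤ 0 := mul_nonpos_of_nonneg_of_nonpos (mul_nonneg hb hab) hr
    have := mul_nonpos_of_nonpos_of_nonneg this (exp_pos ((a + b) * u)).le
    exact mul_nonpos_of_nonpos_of_nonneg this (by positivity)
  have h2 : 0 ≤ 2 * exp (-(a * u)) * (κ + p * exp (-(a * u)) + r * exp (b * u))
      * (-(a * p) + b * r * exp ((a + b) * u)) ^ 2 :=
    mul_nonneg (mul_nonneg (by positivity) hy) (sq_nonneg _)
  linarith

/-- strict (L−), one row: `r < 0`, `0 < b`, `0 < a + b`. [this file's theorem] -/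
theorem topSummand_deriv_neg (a b κ p r u : ℝ) (hb : 0 < b) (hab : 0 < a + b) (hr : r < 0)
    (hy : 0 ≤ κ + p * exp (-(a * u)) + r * exp (b * u)) :
    ((b * (a + b) * r * exp ((a + b) * u)) * (1 + (κ + p * exp (-(a * u)) + r * exp (b * u)) ^ 2)
        - (-(a * p) + b * r * exp ((a + b) * u))
          * (2 * (κ + p * exp (-(a * u)) + r * exp (b * u))
            * (-(a * p) * exp (-(a * u)) + b * r * exp (b * u))))
        / (1 + (κ + p * exp (-(a * u)) + r * exp (b * u)) ^ 2) ^ 2 < 0 := by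
  rw [crossTerm_top]
  apply div_neg_of_neg_of_pos _ (by positivity)
  have h1 : b * (a + b) * r * exp ((a + b) * u) * (1 + (κ + p * exp (-(a * u)) + r * exp (b * u)) ^ 2)
      < 0 := by
    have : b * (a + b) * r < 0 := mul_neg_of_pos_of_neg (mul_pos hb hab) hr
    have := mul_neg_of_neg_of_pos this (exp_pos ((a + b) * u))
    exact mul_neg_of_neg_of_pos this (by positivity)
  have h2 : 0 ≤ 2 * exp (-(a * u)) * (κ + p * exp (-(a * u)) + r * exp (b * u))
      * (-(a * p) + b * r * exp ((a + b) * u)) ^ 2 :=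
    mul_nonneg (mul_nonneg (by positivity) hy) (sq_nonneg _)
  linarith

/-- **MIRROR LAW (L+), one row**: `r ≥ 0` at NEGATIVE phase (`y ≤ 0`) ⇒ the upper summand is non-decreasing.
[this file's theorem] -/
theorem topSummand_deriv_nonneg (a b κ p r u : ℝ) (hb : 0 ≤ b) (hab : 0 ≤ a + b) (hr : 0 ≤ r)
    (hy : κ + p * exp (-(a * u)) + r * exp (b * u) ≤ 0) :
    0 ≤ ((b * (a + b) * r * exp ((a + b) * u)) * (1 + (κ + p * exp (-(a * u)) + r * exp (b * u)) ^ 2)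
        - (-(a * p) + b * r * exp ((a + b) * u))
          * (2 * (κ + p * exp (-(a * u)) + r * exp (b * u))
            * (-(a * p) * exp (-(a * u)) + b * r * exp (b * u))))
        / (1 + (κ + p * exp (-(a * u)) + r * exp (b * u)) ^ 2) ^ 2 := by
  rw [crossTerm_top]
  apply div_nonneg _ (by positivity)
  have h1 : 0 ≤ b * (a + b) * r * exp ((a + b) * u)
      * (1 + (κ + p * exp (-(a * u)) + r * exp (b * u)) ^ 2) := by
    have : 0 ≤ b * (a + b) * r := mul_nonneg (mul_nonneg hb hab) hr
    exact mul_nonneg (mul_nonneg this (exp_pos _).le) (by positivity)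
  have h2 : 2 * exp (-(a * u)) * (κ + p * exp (-(a * u)) + r * exp (b * u))
      * (-(a * p) + b * r * exp ((a + b) * u)) ^ 2 ≤ 0 :=
    mul_nonpos_of_nonpos_of_nonneg (mul_nonpos_of_nonneg_of_nonpos (by positivity) hy) (sq_nonneg _)
  linarith

/-- **MIRROR LAW (R+), one row** (lower envelope of p827068: summand `c/(1+y²)`, `c = -a p e^{-(a+b)u} + b r`):
`p ≥ 0` at NEGATIVE phase ⇒ its derivative is `≥ 0`. [this file's theorem] -/
theorem reducedSummand_deriv_nonneg (a b κ p r u : ℝ) (ha : 0 ≤ a) (hab : 0 ≤ a + b) (hp : 0 ≤ p)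
    (hy : κ + p * exp (-(a * u)) + r * exp (b * u) ≤ 0) :
    0 ≤ ((a * (a + b) * p * exp (-((a + b) * u))) * (1 + (κ + p * exp (-(a * u)) + r * exp (b * u)) ^ 2)
        - (-(a * p) * exp (-((a + b) * u)) + b * r)
          * (2 * (κ + p * exp (-(a * u)) + r * exp (b * u))
            * (-(a * p) * exp (-(a * u)) + b * r * exp (b * u))))
        / (1 + (κ + p * exp (-(a * u)) + r * exp (b * u)) ^ 2) ^ 2 := by
  have hlow : -(a * p) * exp (-(a * u)) + b * r * exp (b * u)
      = exp (b * u) * (-(a * p) * exp (-((a + b) * u)) + b * r) := by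
    have h : exp (b * u) * exp (-((a + b) * u)) = exp (-(a * u)) := by
      rw [← Real.exp_add]; ring_nf
    linear_combination (a * p) * h
  have hcross : (-(a * p) * exp (-((a + b) * u)) + b * r)
        * (2 * (κ + p * exp (-(a * u)) + r * exp (b * u))
          * (-(a * p) * exp (-(a * u)) + b * r * exp (b * u)))
      = 2 * exp (b * u) * (κ + p * exp (-(a * u)) + r * exp (b * u))
          * (-(a * p) * exp (-((a + b) * u)) + b * r) ^ 2 := by
    rw [hlow]; ring
  rw [hcross]
  apply div_nonneg _ (by positivity)
  have h1 : 0 ≤ a * (a + b) * p * exp (-((a + b) * u))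
      * (1 + (κ + p * exp (-(a * u)) + r * exp (b * u)) ^ 2) := by
    have : 0 ≤ a * (a + b) * p := mul_nonneg (mul_nonneg ha hab) hp
    exact mul_nonneg (mul_nonneg this (exp_pos _).le) (by positivity)
  have h2 : 2 * exp (b * u) * (κ + p * exp (-(a * u)) + r * exp (b * u))
      * (-(a * p) * exp (-((a + b) * u)) + b * r) ^ 2 ≤ 0 :=
    mul_nonpos_of_nonpos_of_nonneg (mul_nonpos_of_nonneg_of_nonpos (by positivity) hy) (sq_nonneg _)
  linarith

/-- **Derivative of the upper reduced velocity of a company.** [this file's theorem] -/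
theorem hasDerivAt_topVelocity (a b κ u : ℝ) (p r : ι → ℝ) :
    HasDerivAt (fun u => ∑ i, (-(a * p i) + b * r i * exp ((a + b) * u))
        / (1 + (κ + p i * exp (-(a * u)) + r i * exp (b * u)) ^ 2))
      (∑ i, ((b * (a + b) * r i * exp ((a + b) * u))
          * (1 + (κ + p i * exp (-(a * u)) + r i * exp (b * u)) ^ 2)
        - (-(a * p i) + b * r i * exp ((a + b) * u))
          * (2 * (κ + p i * exp (-(a * u)) + r i * exp (b * u))
            * (-(a * p i) * exp (-(a * u)) + b * r i * exp (b * u))))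
        / (1 + (κ + p i * exp (-(a * u)) + r i * exp (b * u)) ^ 2) ^ 2) u := by
  have h := HasDerivAt.sum (u := (Finset.univ : Finset ι))
    (fun i _ => hasDerivAt_topSummand a b κ (p i) (r i) u)
  have e : (∑ i, fun v : ℝ => (-(a * p i) + b * r i * exp ((a + b) * v))
        / (1 + (κ + p i * exp (-(a * v)) + r i * exp (b * v)) ^ 2))
      = fun v => ∑ i, (-(a * p i) + b * r i * exp ((a + b) * v))
        / (1 + (κ + p i * exp (-(a * v)) + r i * exp (b * v)) ^ 2) := by
    funext v
    exact Finset.sum_apply v Finset.univ _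
  rw [e] at h
  exact h

/-- **MIRROR LAW (L−), company form, strict**: upper-aligned company (`r_i ≤ 0`, one `r_{i₀} < 0`) at a
positive-phase point ⇒ `L'(u) < 0`. [this file's theorem] -/
theorem topVelocity_deriv_neg (a b κ u : ℝ) (p r : ι → ℝ) (hb : 0 < b) (hab : 0 < a + b)
    (hr : ∀ i, r i ≤ 0) (i₀ : ι) (hi₀ : r i₀ < 0)
    (hy : ∀ i, 0 ≤ κ + p i * exp (-(a * u)) + r i * exp (b * u)) :
    (∑ i, ((b * (a + b) * r i * exp ((a + b) * u))
          * (1 + (κ + p i * exp (-(a * u)) + r i * exp (b * u)) ^ 2)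
        - (-(a * p i) + b * r i * exp ((a + b) * u))
          * (2 * (κ + p i * exp (-(a * u)) + r i * exp (b * u))
            * (-(a * p i) * exp (-(a * u)) + b * r i * exp (b * u))))
        / (1 + (κ + p i * exp (-(a * u)) + r i * exp (b * u)) ^ 2) ^ 2) < 0 := by
  have hle := fun i (_ : i ∈ (Finset.univ : Finset ι)) =>
    topSummand_deriv_nonpos a b κ (p i) (r i) u hb.le hab.le (hr i) (hy i)
  have hlt := topSummand_deriv_neg a b κ (p i₀) (r i₀) u hb hab hi₀ (hy i₀)
  have hpos := Finset.sum_pos' (fun i hi => neg_nonneg.mpr (hle i hi)) ⟨i₀, Finset.mem_univ _, neg_pos.mpr hlt⟩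
  rw [Finset.sum_neg_distrib] at hpos
  exact neg_pos.mp hpos

/-- **(L−) window form**: on a convex positive-phase window the upper reduced velocity is strictly decreasing.
[this file's theorem] -/
theorem topVelocity_strictAntiOn (a b κ : ℝ) (p r : ι → ℝ) (hb : 0 < b) (hab : 0 < a + b)
    (hr : ∀ i, r i ≤ 0) (i₀ : ι) (hi₀ : r i₀ < 0) (W : Set ℝ) (hW : Convex ℝ W)
    (hy : ∀ u ∈ W, ∀ i, 0 ≤ κ + p i * exp (-(a * u)) + r i * exp (b * u)) :
    StrictAntiOn (fun u => ∑ i, (-(a * p i) + b * r i * exp ((a + b) * u))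
        / (1 + (κ + p i * exp (-(a * u)) + r i * exp (b * u)) ^ 2)) W := by
  apply strictAntiOn_of_deriv_neg hW
  · exact fun u _ => (hasDerivAt_topVelocity a b κ u p r).continuousAt.continuousWithinAt
  · intro u hu
    rw [(hasDerivAt_topVelocity a b κ u p r).deriv]
    exact topVelocity_deriv_neg a b κ u p r hb hab hr i₀ hi₀ (hy u (interior_subset hu))

/-- **(L−) for the phase velocity**: on such a window `Θ' = -F₁` vanishes at most once. [this file's theorem] -/
theorem phaseVelocity_zero_subsingleton_top (a b κ : ℝ) (p r : ι → ℝ) (hb : 0 < b) (hab : 0 < a + b)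
    (hr : ∀ i, r i ≤ 0) (i₀ : ι) (hi₀ : r i₀ < 0) (W : Set ℝ) (hW : Convex ℝ W)
    (hy : ∀ u ∈ W, ∀ i, 0 ≤ κ + p i * exp (-(a * u)) + r i * exp (b * u)) :
    {u ∈ W | ∑ i, (-(a * p i) * exp (-(a * u)) + b * r i * exp (b * u))
        / (1 + (κ + p i * exp (-(a * u)) + r i * exp (b * u)) ^ 2) = 0}.Subsingleton := by
  intro u hu v hv
  rw [Set.mem_setOf_eq, phaseVelocity_eq_zero_iff_top] at hu hv
  exact (topVelocity_strictAntiOn a b κ p r hb hab hr i₀ hi₀ W hW hy).injOn hu.1 hv.1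
    (hu.2.trans hv.2.symm)

/-! ### Localisation in the upper currency and the synchronised-company law -/

/-- **upper coefficient of a T5 row below `lo`**: `r < 0`, all mass `b|r|e^{(a+b)lo} ≤ a|p|` and `u < lo`
⇒ `d(u) > 0`. [this file's lemma] -/
theorem topCoeff_pos_of_lt (a b p r lo u : ℝ) (hab : 0 < a + b) (hb : 0 < b) (hr : r < 0)
    (hlo : b * (-r) * exp ((a + b) * lo) ≤ a * (-p)) (hu : u < lo) :
    0 < -(a * p) + b * r * exp ((a + b) * u) := by
  have hexp : exp ((a + b) * u) < exp ((a + b) * lo) :=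
    Real.exp_lt_exp.mpr (mul_lt_mul_of_pos_left hu hab)
  have hbr : 0 < b * (-r) := mul_pos hb (neg_pos.mpr hr)
  have := mul_lt_mul_of_pos_left hexp hbr
  nlinarith

/-- **upper coefficient of a T5 row above `hi`**: `a|p| ≤ b|r|e^{(a+b)hi}` and `hi < u` ⇒ `d(u) < 0`.
[this file's lemma] -/
theorem topCoeff_neg_of_gt (a b p r hi u : ℝ) (hab : 0 < a + b) (hb : 0 < b) (hr : r < 0)
    (hhi : a * (-p) ≤ b * (-r) * exp ((a + b) * hi)) (hu : hi < u) :
    -(a * p) + b * r * exp ((a + b) * u) < 0 := by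
  have hexp : exp ((a + b) * hi) < exp ((a + b) * u) :=
    Real.exp_lt_exp.mpr (mul_lt_mul_of_pos_left hu hab)
  have hbr : 0 < b * (-r) := mul_pos hb (neg_pos.mpr hr)
  have := mul_lt_mul_of_pos_left hexp hbr
  nlinarith

/-- **LOCALISATION (below, upper currency)**: left of all switch times `L(u) > 0`. [this file's theorem] -/
theorem topVelocity_pos_below [Nonempty ι] (a b κ lo u : ℝ) (p r : ι → ℝ) (hab : 0 < a + b) (hb : 0 < b)
    (hr : ∀ i, r i < 0) (hlo : ∀ i, b * (-r i) * exp ((a + b) * lo) ≤ a * (-p i)) (hu : u < lo) :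
    0 < ∑ i, (-(a * p i) + b * r i * exp ((a + b) * u))
        / (1 + (κ + p i * exp (-(a * u)) + r i * exp (b * u)) ^ 2) := by
  apply Finset.sum_pos _ Finset.univ_nonempty
  intro i _
  exact div_pos (topCoeff_pos_of_lt a b (p i) (r i) lo u hab hb (hr i) (hlo i) hu) (by positivity)

/-- **LOCALISATION (above, upper currency)**: right of all switch times `L(u) < 0`. [this file's theorem] -/
theorem topVelocity_neg_above [Nonempty ι] (a b κ hi u : ℝ) (p r : ι → ℝ) (hab : 0 < a + b) (hb : 0 < b)
    (hr : ∀ i, r i < 0) (hhi : ∀ i, a * (-p i) ≤ b * (-r i) * exp ((a + b) * hi)) (hu : hi < u) :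
    ∑ i, (-(a * p i) + b * r i * exp ((a + b) * u))
        / (1 + (κ + p i * exp (-(a * u)) + r i * exp (b * u)) ^ 2) < 0 := by
  apply Finset.sum_neg _ Finset.univ_nonempty
  intro i _
  exact div_neg_of_neg_of_pos (topCoeff_neg_of_gt a b (p i) (r i) hi u hab hb (hr i) (hhi i) hu)
    (by positivity)

/-- **THE SYNCHRONISED-COMPANY LAW (upper reduced velocity)**: a T5 company (`r_i < 0`) whose switch times all lie
in `[lo, hi]`, every row keeping positive phase on `[lo, hi]`, has an upper reduced velocity `L` with AT MOST ONE
ZERO on the whole line. [this file's theorem] -/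
theorem topVelocity_zero_subsingleton_of_sync [Nonempty ι] (a b κ lo hi : ℝ) (p r : ι → ℝ)
    (hab : 0 < a + b) (hb : 0 < b) (hr : ∀ i, r i < 0)
    (hlo : ∀ i, b * (-r i) * exp ((a + b) * lo) ≤ a * (-p i))
    (hhi : ∀ i, a * (-p i) ≤ b * (-r i) * exp ((a + b) * hi))
    (hy : ∀ u ∈ Set.Icc lo hi, ∀ i, 0 ≤ κ + p i * exp (-(a * u)) + r i * exp (b * u)) :
    {u : ℝ | ∑ i, (-(a * p i) + b * r i * exp ((a + b) * u))
        / (1 + (κ + p i * exp (-(a * u)) + r i * exp (b * u)) ^ 2) = 0}.Subsingleton := by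
  -- every zero lies in `[lo, hi]`
  have hmem : ∀ u, ∑ i, (-(a * p i) + b * r i * exp ((a + b) * u))
        / (1 + (κ + p i * exp (-(a * u)) + r i * exp (b * u)) ^ 2) = 0 → u ∈ Set.Icc lo hi := by
    intro u hu0
    refine ⟨?_, ?_⟩
    · by_contra h
      have hlt : u < lo := lt_of_not_ge h
      exact absurd hu0 (topVelocity_pos_below a b κ lo u p r hab hb hr hlo hlt).ne'
    · by_contra h
      have hgt : hi < u := lt_of_not_ge h
      exact absurd hu0 (topVelocity_neg_above a b κ hi u p r hab hb hr hhi hgt).ne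
  obtain ⟨i₀⟩ := ‹Nonempty ι›
  have hanti := topVelocity_strictAntiOn a b κ p r hb hab (fun i => (hr i).le) i₀ (hr i₀) (Set.Icc lo hi)
    (convex_Icc lo hi) hy
  intro u hu v hv
  rw [Set.mem_setOf_eq] at hu hv
  exact hanti.injOn (hmem u hu) (hmem v hv) (hu.trans hv.symm)

/-- **THE SYNCHRONISED-COMPANY LAW for the phase velocity** `Θ' = -F₁`: at most one zero on the whole line,
for any number of clouds. [this file's theorem] -/
theorem phaseVelocity_zero_subsingleton_of_sync [Nonempty ι] (a b κ lo hi : ℝ) (p r : ι → ℝ)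
    (hab : 0 < a + b) (hb : 0 < b) (hr : ∀ i, r i < 0)
    (hlo : ∀ i, b * (-r i) * exp ((a + b) * lo) ≤ a * (-p i))
    (hhi : ∀ i, a * (-p i) ≤ b * (-r i) * exp ((a + b) * hi))
    (hy : ∀ u ∈ Set.Icc lo hi, ∀ i, 0 ≤ κ + p i * exp (-(a * u)) + r i * exp (b * u)) :
    {u : ℝ | ∑ i, (-(a * p i) * exp (-(a * u)) + b * r i * exp (b * u))
        / (1 + (κ + p i * exp (-(a * u)) + r i * exp (b * u)) ^ 2) = 0}.Subsingleton := by
  intro u hu v hv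
  rw [Set.mem_setOf_eq, phaseVelocity_eq_zero_iff_top] at hu hv
  exact topVelocity_zero_subsingleton_of_sync a b κ lo hi p r hab hb hr hlo hhi hy hu hv

end Summit.ValiantsHypothesis.ValiantsHypothesis.Theorems.LacunarySymmetroidMatrixDescartes.ProductPlusOne.LensCloudTop
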